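import Summits.Ventures.PercRepro.C025ProfilePLDSevenLiftSix
import Summits.Ventures.PercRepro.C025ProfilePLDFiveLiftCorollaries
import Summits.Ventures.PercRepro.C025ProfilePLDSolidLiftCorollaries
import Summits.Ventures.PercRepro.C025ProfilePLDPlaneLiftCorollaries
import Summits.Ventures.PercRepro.C025ProfilePLDUniformTwoLiftCorollaries
import Summits.Ventures.PercRepro.C025ProfilePLDRankThree
import Summits.Ventures.PercRepro.C025ProfilePLDSevenLiftFiveCorollaries

/-!
# THE RANK-7 UNIFORM SUMMAND AT RANK ≤ 6: (PLD)-MATROIDS OF RANK ≤ 6 ⊕ U_{7,m} (night-3 g33)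

`proofs/NIGHT3-G33-RANKEIGHT.md` §6–§7.  With `PLDSevenLift.pld_disjointSum_uniform_seven_ge_13_of_eRank_le_6` — (PLD)(M) ∧ rank M ≤ 6 ⟹ (PLD)(M ⊕ U_{7,m}) for every
`m ≥ 13` — and the landed rank-3 bases ((PLD) for every matroid of rank ≤ 3, `PLDParExt.pld_of_eRank_le_three`; the lines, planes,
solids of g31/g32): (PLD), hence C-025 at every `(p, q)` on every truncation of `N ⊕ free points`, for `N` = «any (PLD)-matroid of
rank ≤ 6 ⊕ U_{7,m}», «rank ≤ 3 ⊕ any plane with ≥ 5 points ⊕ U_{7,m}» (`m ≥ 13`).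
No `def`, no `instance`, no notation.  Axioms: standard.
-/

open scoped Matroid

namespace PercRepro

open Finset ThmH

namespace PLDSevenLift

variable {α : Type} [DecidableEq α]

/-- C-025 AT EVERY `(p, q)` ON EVERY TRUNCATION OF «(PLD)-MATROID OF RANK ≤ 6 ⊕ U_{7,m} WITH m ≥ 13 ⊕ FREE POINTS». -/
theorem rls_truncate_disjointSum_seven_freeOn_of_pld_six (M : Matroid α) [M.Finite] (hr : M.eRank ≤ 6)
    (hPLD : ∀ lo hi δ Θ : ℕ, Θ ≤ lo + hi + δ → (lo = 0 ∨ lo + hi + δ ≤ Θ) →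
      (∑ I ∈ (gr M).powerset, (if lo ≤ (M.eRk (I : Set α)).toNat ∧ (M.eRk (I : Set α)).toNat ≤ hi ∧
          Θ ≤ (M.eRk ((gr M \ I : Finset α) : Set α)).toNat + (M.eRk (I : Set α)).toNat then
          ((M.eRk ((gr M \ I : Finset α) : Set α)).toNat).choose δ else 0)) ≤
        ∑ I ∈ (gr M).powerset, (if lo + δ ≤ (M.eRk ((gr M \ I : Finset α) : Set α)).toNat ∧
          (M.eRk ((gr M \ I : Finset α) : Set α)).toNat ≤ hi + δ then
          ((M.eRk ((gr M \ I : Finset α) : Set α)).toNat).choose δ else 0))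
    (F : Finset α) (hF : 13 ≤ F.card) (h : Disjoint M.E (@Matroid.truncate α (Matroid.freeOn (F : Set α)) (PLDTruncate.freeOn_finite' F) 7).E)
    (E₃ : Finset α) (h₃ : Disjoint (M.disjointSum (@Matroid.truncate α (Matroid.freeOn (F : Set α)) (PLDTruncate.freeOn_finite' F) 7) h).E (E₃ : Set α)) (r p q : ℕ) :
    haveI := PLDTruncate.freeOn_finite' F
    haveI := PLDClosure.disjointSum_finite' _ _ h
    haveI := PLDBridge.disjointSum_freeOn_finite _ E₃ h₃
    ThmN.RLS (PercRepro.Matroid.truncate ((M.disjointSum (@Matroid.truncate α (Matroid.freeOn (F : Set α)) (PLDTruncate.freeOn_finite' F) 7) h).disjointSum (Matroid.freeOn (E₃ : Set α)) h₃) r) p q := by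
  haveI := PLDTruncate.freeOn_finite' F
  haveI := PLDClosure.disjointSum_finite' _ _ h
  exact PLDBridge.rls_disjointSum_freeOn_of_pld _ E₃ h₃ r p q (pld_disjointSum_uniform_seven_ge_13_of_eRank_le_6 M hr hPLD F hF h)

/-- (PLD) FOR «RANK ≤ 3 ⊕ ANY PLANE WITH ≥ 5 POINTS ⊕ U_{7,m} WITH m ≥ 13» (unconditional; the any plane with ≥ 5 points first, then the rank-7 summand at rank ≤ 6). -/
theorem pld_disjointSum_plane_seven_of_eRank_le_three (M : Matroid α) [M.Finite] (h3 : M.eRank ≤ 3)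
    (F₁ : Finset α) (hF₁ : 5 ≤ F₁.card) (h₁ : Disjoint M.E (@Matroid.truncate α (Matroid.freeOn (F₁ : Set α)) (PLDTruncate.freeOn_finite' F₁) 3).E)
    (F₂ : Finset α) (hF₂ : 13 ≤ F₂.card)
    (h₂ : Disjoint (M.disjointSum (@Matroid.truncate α (Matroid.freeOn (F₁ : Set α)) (PLDTruncate.freeOn_finite' F₁) 3) h₁).E (@Matroid.truncate α (Matroid.freeOn (F₂ : Set α)) (PLDTruncate.freeOn_finite' F₂) 7).E) :
    haveI := PLDTruncate.freeOn_finite' F₁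
    haveI := PLDTruncate.freeOn_finite' F₂
    haveI := PLDClosure.disjointSum_finite' _ _ h₁
    haveI := PLDClosure.disjointSum_finite' _ _ h₂
    ∀ lo hi δ Θ : ℕ, Θ ≤ lo + hi + δ → (lo = 0 ∨ lo + hi + δ ≤ Θ) →
      (∑ I ∈ (gr ((M.disjointSum (@Matroid.truncate α (Matroid.freeOn (F₁ : Set α)) (PLDTruncate.freeOn_finite' F₁) 3) h₁).disjointSum (@Matroid.truncate α (Matroid.freeOn (F₂ : Set α)) (PLDTruncate.freeOn_finite' F₂) 7) h₂)).powerset, (if lo ≤ (((M.disjointSum (@Matroid.truncate α (Matroid.freeOn (F₁ : Set α)) (PLDTruncate.freeOn_finite' F₁) 3) h₁).disjointSum (@Matroid.truncate α (Matroid.freeOn (F₂ : Set α)) (PLDTruncate.freeOn_finite' F₂) 7) h₂).eRk (I : Set α)).toNat ∧ (((M.disjointSum (@Matroid.truncate α (Matroid.freeOn (F₁ : Set α)) (PLDTruncate.freeOn_finite' F₁) 3) h₁).disjointSum (@Matroid.truncate α (Matroid.freeOn (F₂ : Set α)) (PLDTruncate.freeOn_finite' F₂) 7) h₂).eRk (I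 : Set α)).toNat ≤ hi ∧
          Θ ≤ (((M.disjointSum (@Matroid.truncate α (Matroid.freeOn (F₁ : Set α)) (PLDTruncate.freeOn_finite' F₁) 3) h₁).disjointSum (@Matroid.truncate α (Matroid.freeOn (F₂ : Set α)) (PLDTruncate.freeOn_finite' F₂) 7) h₂).eRk ((gr ((M.disjointSum (@Matroid.truncate α (Matroid.freeOn (F₁ : Set α)) (PLDTruncate.freeOn_finite' F₁) 3) h₁).disjointSum (@Matroid.truncate α (Matroid.freeOn (F₂ : Set α)) (PLDTruncate.freeOn_finite' F₂) 7) h₂) \ I : Finset α) : Set α)).toNat + (((M.disjointSum (@Matroid.truncate α (Matroid.freeOn (F₁ : Set α)) (PLDTruncate.freeOn_finite' F₁) 3) h₁).disjointSum (@Matroid.truncate α (Matroid.freeOn (F₂ : Set α)) (PLDTruncate.freeOn_finite' F₂) 7) h₂).eRk (I : Set α)).toNat then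
          ((((M.disjointSum (@Matroid.truncate α (Matroid.freeOn (F₁ : Set α)) (PLDTruncate.freeOn_finite' F₁) 3) h₁).disjointSum (@Matroid.truncate α (Matroid.freeOn (F₂ : Set α)) (PLDTruncate.freeOn_finite' F₂) 7) h₂).eRk ((gr ((M.disjointSum (@Matroid.truncate α (Matroid.freeOn (F₁ : Set α)) (PLDTruncate.freeOn_finite' F₁) 3) h₁).disjointSum (@Matroid.truncate α (Matroid.freeOn (F₂ : Set α)) (PLDTruncate.freeOn_finite' F₂) 7) h₂) \ I : Finset α) : Set α)).toNat).choose δ else 0)) ≤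
        ∑ I ∈ (gr ((M.disjointSum (@Matroid.truncate α (Matroid.freeOn (F₁ : Set α)) (PLDTruncate.freeOn_finite' F₁) 3) h₁).disjointSum (@Matroid.truncate α (Matroid.freeOn (F₂ : Set α)) (PLDTruncate.freeOn_finite' F₂) 7) h₂)).powerset, (if lo + δ ≤ (((M.disjointSum (@Matroid.truncate α (Matroid.freeOn (F₁ : Set α)) (PLDTruncate.freeOn_finite' F₁) 3) h₁).disjointSum (@Matroid.truncate α (Matroid.freeOn (F₂ : Set α)) (PLDTruncate.freeOn_finite' F₂) 7) h₂).eRk ((gr ((M.disjointSum (@Matroid.truncate α (Matroid.freeOn (F₁ : Set α)) (PLDTruncate.freeOn_finite' F₁) 3) h₁).disjointSum (@Matroid.truncate α (Matroid.freeOn (F₂ : Set α)) (PLDTruncate.freeOn_finite' F₂) 7) h₂) \ I : Finset α) : Set α)).toNat ∧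
          (((M.disjointSum (@Matroid.truncate α (Matroid.freeOn (F₁ : Set α)) (PLDTruncate.freeOn_finite' F₁) 3) h₁).disjointSum (@Matroid.truncate α (Matroid.freeOn (F₂ : Set α)) (PLDTruncate.freeOn_finite' F₂) 7) h₂).eRk ((gr ((M.disjointSum (@Matroid.truncate α (Matroid.freeOn (F₁ : Set α)) (PLDTruncate.freeOn_finite' F₁) 3) h₁).disjointSum (@Matroid.truncate α (Matroid.freeOn (F₂ : Set α)) (PLDTruncate.freeOn_finite' F₂) 7) h₂) \ I : Finset α) : Set α)).toNat ≤ hi + δ then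
          ((((M.disjointSum (@Matroid.truncate α (Matroid.freeOn (F₁ : Set α)) (PLDTruncate.freeOn_finite' F₁) 3) h₁).disjointSum (@Matroid.truncate α (Matroid.freeOn (F₂ : Set α)) (PLDTruncate.freeOn_finite' F₂) 7) h₂).eRk ((gr ((M.disjointSum (@Matroid.truncate α (Matroid.freeOn (F₁ : Set α)) (PLDTruncate.freeOn_finite' F₁) 3) h₁).disjointSum (@Matroid.truncate α (Matroid.freeOn (F₂ : Set α)) (PLDTruncate.freeOn_finite' F₂) 7) h₂) \ I : Finset α) : Set α)).toNat).choose δ else 0) := by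
  haveI := PLDTruncate.freeOn_finite' F₁
  haveI := PLDTruncate.freeOn_finite' F₂
  haveI := PLDClosure.disjointSum_finite' _ _ h₁
  have h1 := PLDPlaneLift.pld_disjointSum_plane_of_eRank_le_three M h3 F₁ hF₁ h₁
  have hr1 : (M.disjointSum (@Matroid.truncate α (Matroid.freeOn (F₁ : Set α)) (PLDTruncate.freeOn_finite' F₁) 3) h₁).eRank ≤ 6 := by
    rw [PLDTwoLiftGen.eRank_disjointSum]
    calc M.eRank + (@Matroid.truncate α (Matroid.freeOn (F₁ : Set α)) (PLDTruncate.freeOn_finite' F₁) 3).eRank ≤ 3 + 3 := add_le_add h3 (PLDPlaneLift.eRank_plane_le F₁)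
      _ ≤ 6 := by norm_num
  exact pld_disjointSum_uniform_seven_ge_13_of_eRank_le_6 _ hr1 h1 F₂ hF₂ h₂

/-- C-025 AT EVERY `(p, q)` ON EVERY TRUNCATION OF «RANK ≤ 3 ⊕ ANY PLANE WITH ≥ 5 POINTS ⊕ U_{7,m} WITH m ≥ 13 ⊕ FREE POINTS». -/
theorem rls_truncate_disjointSum_plane_seven_freeOn_of_eRank_le_three (M : Matroid α) [M.Finite] (h3 : M.eRank ≤ 3)
    (F₁ : Finset α) (hF₁ : 5 ≤ F₁.card) (h₁ : Disjoint M.E (@Matroid.truncate α (Matroid.freeOn (F₁ : Set α)) (PLDTruncate.freeOn_finite' F₁) 3).E)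
    (F₂ : Finset α) (hF₂ : 13 ≤ F₂.card)
    (h₂ : Disjoint (M.disjointSum (@Matroid.truncate α (Matroid.freeOn (F₁ : Set α)) (PLDTruncate.freeOn_finite' F₁) 3) h₁).E (@Matroid.truncate α (Matroid.freeOn (F₂ : Set α)) (PLDTruncate.freeOn_finite' F₂) 7).E)
    (E₃ : Finset α) (h₃ : Disjoint ((M.disjointSum (@Matroid.truncate α (Matroid.freeOn (F₁ : Set α)) (PLDTruncate.freeOn_finite' F₁) 3) h₁).disjointSum (@Matroid.truncate α (Matroid.freeOn (F₂ : Set α)) (PLDTruncate.freeOn_finite' F₂) 7) h₂).E (E₃ : Set α)) (r p q : ℕ) :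
    haveI := PLDTruncate.freeOn_finite' F₁
    haveI := PLDTruncate.freeOn_finite' F₂
    haveI := PLDClosure.disjointSum_finite' _ _ h₁
    haveI := PLDClosure.disjointSum_finite' _ _ h₂
    haveI := PLDBridge.disjointSum_freeOn_finite _ E₃ h₃
    ThmN.RLS (PercRepro.Matroid.truncate (((M.disjointSum (@Matroid.truncate α (Matroid.freeOn (F₁ : Set α)) (PLDTruncate.freeOn_finite' F₁) 3) h₁).disjointSum (@Matroid.truncate α (Matroid.freeOn (F₂ : Set α)) (PLDTruncate.freeOn_finite' F₂) 7) h₂).disjointSum (Matroid.freeOn (E₃ : Set α)) h₃) r) p q := by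
  haveI := PLDTruncate.freeOn_finite' F₁
  haveI := PLDTruncate.freeOn_finite' F₂
  haveI := PLDClosure.disjointSum_finite' _ _ h₁
  haveI := PLDClosure.disjointSum_finite' _ _ h₂
  exact PLDBridge.rls_disjointSum_freeOn_of_pld _ E₃ h₃ r p q
    (pld_disjointSum_plane_seven_of_eRank_le_three M h3 F₁ hF₁ h₁ F₂ hF₂ h₂)
end PLDSevenLift

end PercRepro
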